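import Summits.HodgeConjecture.HodgeConjecture.Theorems.MilnorKExponentialSymbolClassesAlgebraicNashHighBand
import Literature.AlgebraicGeometry.HodgeTheory.ComplexOrientationFamily

/-!
# Line `NashDescentSketch`, stub (W_alg-band): the residual hypotheses of the landed reductions are at the height of the stub (certificate)

Crux `SymbolClassesAlgebraic` (stmt-HodgeConjecture-17743, route `MilnorKExponential`), line
`NashDescentSketch`, band stub (W_alg-band) `stub_nashHighBandAlgebraic` (rational Nash symbol
classes of weight `3 ≤ q + 1 ≤ n - 2` are algebraic). The landed reductions (p160658) are
`hZ → blochOgus1974_zariskiTransgression_algebraic → (W_alg-band)` and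
`hG' → hZL → blochOgus1974_zariskiTransgression_algebraic → (W_alg-band)`, where
* `hZ`  = after a base change of non-zero degree the class is a Čech–de Rham transgression over a
  ZARISKI open cover;
* `hG'` = after a base change of non-zero degree the class carries a Milnor symbol cocycle whose
  units are values of REGULAR functions (Zariski labels);
* `hZL` = a class with a regular-unit symbol cocycle on an ANALYTIC cover is a Zariski transgression.
This file records, sorry-free, that `hG'` and `hZ` are implied by the CONCLUSION of the stub (every
rational Nash symbol class in the band is algebraic) together with the natural Zariski forms of the
route's typing item "algebraic classes are symbol classes" (Alg ⊆ L, stmt-HodgeConjecture-18703 —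
here with REGULAR units, resp. as Zariski transgressions; both are the Bloch–Quillen–Kerz / Koszul
content of 2001 Thm A and hold for algebraic classes in kind):
`zariskiLabelGlobalisation_of_highBand`, `zariskiDescent_of_highBand` — base change `W = X`,
`φ = 𝟙`, `d = 1` with the complex orientation (`hasDegree_one_id`). So neither residual hypothesis
is a statement strictly below the stub: modulo typing they ARE the stub (which is itself a
consequence of the crux, `Negative/LineCeiling.not_symbolClassesAlgebraic_of_not_nashHighBand`), and
the only hypothesis of the chain with independent content is `hZL` (analytic cover ⇒ Zariski cover),
unprinted. Companion of `…NashWeightTwoBandCircular.lean` (W₁-band: `hG` circular outright).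

The two typing statements are route-posited STATEMENTS (`def … : Prop`, untagged), not results.
-/

noncomputable section

open scoped Manifold
open CategoryTheory AlgebraicGeometry
open Literature.AlgebraicTopology.SingularHomology (HomologicalOrientation HasDegree hasDegree_one_id)

-- mandated namespace repeats `HodgeConjecture` (single-conjunct summit)
set_option linter.dupNamespace false

namespace Summit.HodgeConjecture.HodgeConjecture.Cruxes.SymbolClassesAlgebraic.NashHighBandCostume

open Literature.AlgebraicGeometry Literature.AlgebraicGeometry.HodgeTheory
  Literature.AlgebraicGeometry.Motives Literature.Geometry.Kaehler
  Literature.NumberTheory.Transcendental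
open Summit.HodgeConjecture.HodgeConjecture.Theorems.MilnorKExponentialNash

/-- **Typing statement (Zariski-labelled form of Alg ⊆ L in the band):** a rational ALGEBRAIC class
of weight `q + 1`, `2 ≤ q`, `q + 3 ≤ n`, carries on some Hodge model a Milnor symbol cocycle whose
units are values of regular functions (the Koszul / Bloch–Quillen–Kerz cocycles of 2001 Thm A are
of this form). Route-posited STATEMENT, not a result. -/
def AlgebraicClassesCarryRegularSymbolCocycles : Prop :=
  ∀ ⦃n : ℕ⦄ ⦃X : SchemeOver ℂ⦄, IsSmoothProjective n X → ∀ (q : ℕ), 2 ≤ q → q + 3 ≤ n →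
    ∀ (c : complexBetti X (2 * (q + 1))), IsRationalClass c → c ∈ algebraicClasses X (q + 1) →
      ∃ (B : HodgeModel n X) (ι : Type) (_ : Fintype ι) (U : ι → Set B.carrier)
        (hU : ∀ i, IsOpen (U i)) (_ : ∀ x, ∃ i, x ∈ U i)
        (σ : (Fin (q + 2) → ι) → ((Fin (q + 1) → B.carrier → ℂ) →₀ ℤ))
        (_ : IsMilnorSymbolCocycle B.model U σ)
        (_ : ∀ J, ∀ t ∈ (σ J).support, ∀ k, ∃ (O : X.left.Opens) (s : Γ(X.left, O)),
          cechSet U J ⊆ B.toComplexPoints ⁻¹' {P | P.pt ∈ O} ∧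
            ∀ y ∈ cechSet U J, t k y = AlgPoints.evalOrZero O s (B.toComplexPoints y))
        (θ : cclosedSmoothForms B.model B.carrier (2 * q + 1 + 1)) (m : ℤ),
        m ≠ 0 ∧ IsTransgression hU q (fun J ↦ symbolForm B.model (q + 1) (σ J)) θ ∧
          B.deRham B.carrier (2 * q + 1 + 1)
              (complexDeRhamCohomology.mk B.model B.carrier (2 * q + 1 + 1) θ) =
            (m : ℂ) • B.pullback (2 * q + 1 + 1) c

/-- **Typing statement (Zariski-transgression form of Alg ⊆ L in the band):** a rational ALGEBRAIC
class of weight `q + 1`, `2 ≤ q`, `q + 3 ≤ n`, is on some Hodge model a Čech–de Rham transgression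
over (the analytification of) a ZARISKI open cover. Route-posited STATEMENT, not a result. -/
def AlgebraicClassesAreZariskiTransgressions : Prop :=
  ∀ ⦃n : ℕ⦄ ⦃X : SchemeOver ℂ⦄, IsSmoothProjective n X → ∀ (q : ℕ), 2 ≤ q → q + 3 ≤ n →
    ∀ (c : complexBetti X (2 * (q + 1))), IsRationalClass c → c ∈ algebraicClasses X (q + 1) →
      ∃ (B : HodgeModel n X) (ι : Type) (V : ι → X.left.Opens) (U : ι → Set B.carrier)
        (hU : ∀ i, IsOpen (U i)),
        (∀ i, U i = B.toComplexPoints ⁻¹' {P | P.pt ∈ V i}) ∧ (∀ x, ∃ i, x ∈ U i) ∧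
        ∃ (w : (Fin (q + 2) → ι) → MForm 𝓘(ℝ, B.model) B.carrier ℂ (q + 1))
          (θ : cclosedSmoothForms B.model B.carrier (2 * q + 1 + 1)) (m : ℤ),
          IsTransgression hU q w θ ∧ m ≠ 0 ∧
          B.deRham B.carrier (2 * q + 1 + 1)
              (complexDeRhamCohomology.mk B.model B.carrier (2 * q + 1 + 1) θ) =
            (m : ℂ) • B.pullback (2 * q + 1 + 1) c

/-- The conclusion of the stub (W_alg-band), as a named statement (verbatim the registered
signature of `stub_nashHighBandAlgebraic`). -/
def HighBand : Prop :=
  ∀ ⦃n : ℕ⦄ ⦃X : SchemeOver ℂ⦄, IsSmoothProjective n X → ∀ (q : ℕ), 2 ≤ q → q + 3 ≤ n →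
    ∀ (c : complexBetti X (2 * (q + 1))), IsRationalClass c → IsNashSymbolClass n X q c →
      c ∈ algebraicClasses X (q + 1)

/-- **(W_alg-band) ∧ (regular-unit typing) ⇒ `hG'`** (verbatim the first hypothesis of
`nashHighBandAlgebraic_of_globalisation`, p160658): base change `W = X`, `φ = 𝟙 X`, the complex
orientation on both sides, `d = 1` (`hasDegree_one_id`), and the regular-unit cocycle the typing
statement provides for the (algebraic, by the stub) class `c = (𝟙 X)^* c`. [folklore] -/
theorem zariskiLabelGlobalisation_of_highBand (h : HighBand)
    (hT : AlgebraicClassesCarryRegularSymbolCocycles) :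
    ∀ ⦃n : ℕ⦄ ⦃X : SchemeOver ℂ⦄, IsSmoothProjective n X → ∀ (q : ℕ), 2 ≤ q → q + 3 ≤ n →
      ∀ (c : complexBetti X (2 * (q + 1))), IsRationalClass c → IsNashSymbolClass n X q c →
        ∃ (W : SchemeOver ℂ) (φ : W ⟶ X) (μ : HomologicalOrientation ℂ (ComplexPoints W) (2 * n))
          (ν : HomologicalOrientation ℂ (ComplexPoints X) (2 * n)) (d : ℤ),
          IsSmoothProjective n W ∧ d ≠ 0 ∧ HasDegree μ ν (AlgPoints.mapContinuous (L := ℂ) φ) d ∧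
          ∃ (B : HodgeModel n W) (ι : Type) (_ : Fintype ι) (U : ι → Set B.carrier)
            (hU : ∀ i, IsOpen (U i)) (_ : ∀ x, ∃ i, x ∈ U i)
            (σ : (Fin (q + 2) → ι) → ((Fin (q + 1) → B.carrier → ℂ) →₀ ℤ))
            (_ : IsMilnorSymbolCocycle B.model U σ)
            (_ : ∀ J, ∀ t ∈ (σ J).support, ∀ k, ∃ (O : W.left.Opens) (s : Γ(W.left, O)),
              cechSet U J ⊆ B.toComplexPoints ⁻¹' {P | P.pt ∈ O} ∧
                ∀ y ∈ cechSet U J, t k y = AlgPoints.evalOrZero O s (B.toComplexPoints y))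
            (θ : cclosedSmoothForms B.model B.carrier (2 * q + 1 + 1)) (m : ℤ),
            m ≠ 0 ∧ IsTransgression hU q (fun J ↦ symbolForm B.model (q + 1) (σ J)) θ ∧
              B.deRham B.carrier (2 * q + 1 + 1)
                  (complexDeRhamCohomology.mk B.model B.carrier (2 * q + 1 + 1) θ) =
                (m : ℂ) • B.pullback (2 * q + 1 + 1) (complexBetti.map φ (2 * (q + 1)) c) := by
  intro n X hX q hq hqn c hc hs
  have halg : c ∈ algebraicClasses X (q + 1) := h hX q hq hqn c hc hs
  obtain ⟨B, ι, hι, U, hU, hcov, σ, hσ, hreg, θ, m, hm, hT', hdR⟩ := hT hX q hq hqn c hc halg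
  refine ⟨X, 𝟙 X, complexOrientationFamily hX, complexOrientationFamily hX, 1, hX, one_ne_zero, ?_,
    B, ι, hι, U, hU, hcov, σ, hσ, hreg, θ, m, hm, hT', ?_⟩
  · rw [AlgPoints.mapContinuous_id]
    exact hasDegree_one_id _
  · rw [complexBetti.map_id]
    exact hdR

/-- **(W_alg-band) ∧ (Zariski-transgression typing) ⇒ `hZ`** (verbatim the hypothesis of
`nashHighBandAlgebraic_of_zariskiDescent`, p160658): same base change `W = X`, `φ = 𝟙`, `d = 1`.
[folklore] -/
theorem zariskiDescent_of_highBand (h : HighBand) (hT : AlgebraicClassesAreZariskiTransgressions) :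
    ∀ ⦃n : ℕ⦄ ⦃X : SchemeOver ℂ⦄, IsSmoothProjective n X → ∀ (q : ℕ), 2 ≤ q → q + 3 ≤ n →
      ∀ (c : complexBetti X (2 * (q + 1))), IsRationalClass c → IsNashSymbolClass n X q c →
        ∃ (W : SchemeOver ℂ) (φ : W ⟶ X) (μ : HomologicalOrientation ℂ (ComplexPoints W) (2 * n))
          (ν : HomologicalOrientation ℂ (ComplexPoints X) (2 * n)) (d : ℤ),
          IsSmoothProjective n W ∧ d ≠ 0 ∧ HasDegree μ ν (AlgPoints.mapContinuous (L := ℂ) φ) d ∧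
          ∃ (B : HodgeModel n W) (ι : Type) (V : ι → W.left.Opens) (U : ι → Set B.carrier)
            (hU : ∀ i, IsOpen (U i)),
            (∀ i, U i = B.toComplexPoints ⁻¹' {P | P.pt ∈ V i}) ∧ (∀ x, ∃ i, x ∈ U i) ∧
            ∃ (w : (Fin (q + 2) → ι) → MForm 𝓘(ℝ, B.model) B.carrier ℂ (q + 1))
              (θ : cclosedSmoothForms B.model B.carrier (2 * q + 1 + 1)) (m : ℤ),
              IsTransgression hU q w θ ∧ m ≠ 0 ∧
              B.deRham B.carrier (2 * q + 1 + 1)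
                  (complexDeRhamCohomology.mk B.model B.carrier (2 * q + 1 + 1) θ) =
                (m : ℂ) • B.pullback (2 * q + 1 + 1) (complexBetti.map φ (2 * (q + 1)) c) := by
  intro n X hX q hq hqn c hc hs
  have halg : c ∈ algebraicClasses X (q + 1) := h hX q hq hqn c hc hs
  obtain ⟨B, ι, V, U, hU, hUV, hcov, w, θ, m, hT', hm, hdR⟩ := hT hX q hq hqn c hc halg
  refine ⟨X, 𝟙 X, complexOrientationFamily hX, complexOrientationFamily hX, 1, hX, one_ne_zero, ?_,
    B, ι, V, U, hU, hUV, hcov, w, θ, m, hT', hm, ?_⟩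
  · rw [AlgPoints.mapContinuous_id]
    exact hasDegree_one_id _
  · rw [complexBetti.map_id]
    exact hdR

/-- **The stub (W_alg-band) is a consequence of the crux** (re-export of the ceiling, for the
record in one place): a rational Nash symbol class is a rational symbol class. [folklore] -/
theorem highBand_of_gkNamed (h : GKNamed) : HighBand :=
  fun _ _ hX q _ _ c hc hs ↦ h hX q c hc hs.isSymbolClass

end Summit.HodgeConjecture.HodgeConjecture.Cruxes.SymbolClassesAlgebraic.NashHighBandCostume

end
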